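import Summits.RiemannHypothesis.RiemannHypothesis.Theorems.TwoPrimeFoldRigidity.Negative.MBTDefs

/-!
# One-lattice moment-blind towers, part 1: cubed-gon algebra

HONEST LABEL.  Negative-side helper toward `¬ IntegerScrew.TwoPrimeFoldRigidity` (item stmt-RiemannHypothesis-25784);
record-negative programme; 0 toward RH.  RH is not proved, not used, not mentioned below.
Nothing here bears on the truth of RH.

Invisibility of a cubed gon at times not divisible by its order (moments `0,1,2`: power sums of a nontrivial root of
unity with one free coordinate each), factorisation `e^{(σ+iγ)t} n³ W_r` at multiples, the shift structure of `W_r`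
under a change of base height, and `|W_r| ≤ M^r`.
-/

set_option linter.dupNamespace false

noncomputable section

open scoped ComplexConjugate
open Complex Finset

namespace Summit.RiemannHypothesis.RiemannHypothesis.Theorems.TwoPrimeFoldRigidity.Negative.MBT

/-! ## §1 Cubed gons: invisibility below the order, factorisation at multiples -/

/-- `Σ_{j<n} ω^j = 0` for a nontrivial `n`-th root of unity. -/
theorem Zs_zero_eq_zero {n : ℕ} {ω : ℂ} (hω : ω ^ n = 1) (hω1 : ω ≠ 1) : Zs n 0 ω = 0 := by
  unfold Zs
  simp only [pow_zero, one_mul]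
  rw [Fin.sum_univ_eq_sum_range (fun j ↦ ω ^ j), geom_sum_eq hω1, hω, sub_self, zero_div]

/-- inner sums `Σ_{j<n} (u + c j)^r ω^j`, `r = 0, 1, 2`, when `Σ ω^j = 0`. -/
theorem inner_sum_zero {n : ℕ} {ω : ℂ} (hZ : Zs n 0 ω = 0) (u c : ℂ) :
    (∑ j : Fin n, (u + c * ((j : ℕ) : ℂ)) ^ 0 * ω ^ (j : ℕ)) = 0 := by
  simpa [Zs] using hZ

/-- inner (third-coordinate) sum of the first power: a combination of `Z_0, Z_1`. -/
theorem inner_sum_one {n : ℕ} {ω : ℂ} (hZ : Zs n 0 ω = 0) (u c : ℂ) :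
    (∑ j : Fin n, (u + c * ((j : ℕ) : ℂ)) ^ 1 * ω ^ (j : ℕ)) = c * Zs n 1 ω := by
  have h0 : ∑ j : Fin n, ω ^ (j : ℕ) = 0 := by simpa [Zs] using hZ
  simp only [pow_one, add_mul, Finset.sum_add_distrib, Zs]
  rw [← Finset.mul_sum, h0, mul_zero, zero_add, Finset.mul_sum]
  refine Finset.sum_congr rfl fun j _ ↦ by ring

/-- inner (third-coordinate) sum of the square: a combination of `Z_0, Z_1, Z_2`. -/
theorem inner_sum_two {n : ℕ} {ω : ℂ} (hZ : Zs n 0 ω = 0) (u c : ℂ) :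
    (∑ j : Fin n, (u + c * ((j : ℕ) : ℂ)) ^ 2 * ω ^ (j : ℕ)) =
      2 * u * c * Zs n 1 ω + c ^ 2 * Zs n 2 ω := by
  have h0 : ∑ j : Fin n, ω ^ (j : ℕ) = 0 := by simpa [Zs] using hZ
  have : ∀ j : Fin n, (u + c * ((j : ℕ) : ℂ)) ^ 2 * ω ^ (j : ℕ) =
      u ^ 2 * ω ^ (j : ℕ) + 2 * u * c * (((j : ℕ) : ℂ) ^ 1 * ω ^ (j : ℕ)) +
        c ^ 2 * (((j : ℕ) : ℂ) ^ 2 * ω ^ (j : ℕ)) := fun j ↦ by ring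
  simp only [this, Finset.sum_add_distrib, ← Finset.mul_sum, h0, mul_zero, zero_add, Zs]

/-- **Invisibility of a cubed gon below its order** (moment orders `0, 1, 2`): if `Σ_{j<n} ω^j = 0` then
`Σ_{j ∈ [n]³} (z + c (j₁+j₂+j₃))^r ω^{j₁+j₂+j₃} = 0` for `r ≤ 2` — every monomial of degree `≤ 2` in three
variables misses one variable, whose factor `Σ ω^j` vanishes. -/
theorem cubed_sum_zero {n : ℕ} {ω : ℂ} (hZ : Zs n 0 ω = 0) (z c : ℂ) {r : ℕ} (hr : r ≤ 2) :
    (∑ j : Fin n × Fin n × Fin n, (z + c * ((tsumIdx j : ℕ) : ℂ)) ^ r * ω ^ tsumIdx j) = 0 := by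
  have h0 : ∑ j : Fin n, ω ^ (j : ℕ) = 0 := by simpa [Zs] using hZ
  -- rewrite as an iterated sum
  have e : ∀ j : Fin n × Fin n × Fin n,
      (z + c * ((tsumIdx j : ℕ) : ℂ)) ^ r * ω ^ tsumIdx j =
        ((z + c * ((j.1 : ℕ) : ℂ) + c * ((j.2.1 : ℕ) : ℂ)) + c * ((j.2.2 : ℕ) : ℂ)) ^ r *
          ω ^ (j.2.2 : ℕ) * (ω ^ (j.1 : ℕ) * ω ^ (j.2.1 : ℕ)) := by
    intro j
    simp only [tsumIdx, Nat.cast_add, pow_add]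
    ring
  simp_rw [e]
  simp only [Fintype.sum_prod_type]
  -- innermost sum
  have step3 : ∀ j1 j2 : Fin n,
      (∑ j3 : Fin n, ((z + c * ((j1 : ℕ) : ℂ) + c * ((j2 : ℕ) : ℂ)) + c * ((j3 : ℕ) : ℂ)) ^ r *
          ω ^ (j3 : ℕ) * (ω ^ (j1 : ℕ) * ω ^ (j2 : ℕ))) =
        (∑ j3 : Fin n, ((z + c * ((j1 : ℕ) : ℂ) + c * ((j2 : ℕ) : ℂ)) + c * ((j3 : ℕ) : ℂ)) ^ r *
          ω ^ (j3 : ℕ)) * (ω ^ (j1 : ℕ) * ω ^ (j2 : ℕ)) := fun j1 j2 ↦ by rw [Finset.sum_mul]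
  simp_rw [step3]
  interval_cases r
  · simp_rw [inner_sum_zero hZ, zero_mul, Finset.sum_const_zero]
  · simp_rw [inner_sum_one hZ]
    have : ∀ j1 : Fin n, (∑ j2 : Fin n, c * Zs n 1 ω * (ω ^ (j1 : ℕ) * ω ^ (j2 : ℕ))) =
        c * Zs n 1 ω * ω ^ (j1 : ℕ) * ∑ j2 : Fin n, ω ^ (j2 : ℕ) := fun j1 ↦ by
      rw [Finset.mul_sum]; exact Finset.sum_congr rfl fun _ _ ↦ by ring
    simp_rw [this, h0, mul_zero, Finset.sum_const_zero]
  · simp_rw [inner_sum_two hZ]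
    have e2 : ∀ j1 : Fin n, (∑ j2 : Fin n, (2 * (z + c * ((j1 : ℕ) : ℂ) + c * ((j2 : ℕ) : ℂ)) * c * Zs n 1 ω +
        c ^ 2 * Zs n 2 ω) * (ω ^ (j1 : ℕ) * ω ^ (j2 : ℕ))) =
        ω ^ (j1 : ℕ) * ∑ j2 : Fin n, ((2 * (z + c * ((j1 : ℕ) : ℂ)) * c * Zs n 1 ω + c ^ 2 * Zs n 2 ω) +
          (2 * c ^ 2 * Zs n 1 ω) * ((j2 : ℕ) : ℂ)) ^ 1 * ω ^ (j2 : ℕ) := fun j1 ↦ by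
      rw [Finset.mul_sum]; exact Finset.sum_congr rfl fun _ _ ↦ by ring
    simp_rw [e2, inner_sum_one hZ]
    have e3 : (∑ j1 : Fin n, ω ^ (j1 : ℕ) * (2 * c ^ 2 * Zs n 1 ω * Zs n 1 ω)) =
        (∑ j1 : Fin n, ω ^ (j1 : ℕ)) * (2 * c ^ 2 * Zs n 1 ω * Zs n 1 ω) := by rw [Finset.sum_mul]
    rw [e3, h0, zero_mul]

/-- the primitive phase `ω = e^{2πik/n}` is an `n`-th root of unity, `≠ 1` unless `n ∣ k`. -/
theorem omega_pow_eq_one (n k : ℕ) (hn : n ≠ 0) :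
    Complex.exp (2 * Real.pi * I * ((k : ℝ) / (n : ℝ) : ℝ)) ^ n = 1 := by
  rw [← Complex.exp_nat_mul]
  have : (n : ℂ) * (2 * Real.pi * I * (((k : ℝ) / (n : ℝ) : ℝ) : ℂ)) = (k : ℕ) * (2 * Real.pi * I) := by
    push_cast
    field_simp
  rw [this]
  exact Complex.exp_nat_mul_two_pi_mul_I k

/-- a root of unity of order not dividing `k` is not `1`. -/
theorem omega_ne_one {n k : ℕ} (hn : n ≠ 0) (hk : ¬ n ∣ k) :
    Complex.exp (2 * Real.pi * I * ((k : ℝ) / (n : ℝ) : ℝ)) ≠ 1 := by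
  intro h
  rw [Complex.exp_eq_one_iff] at h
  obtain ⟨N, hN⟩ := h
  have h2 : (2 * Real.pi * I : ℂ) ≠ 0 := by
    simp [Real.pi_ne_zero]
  have : (((k : ℝ) / (n : ℝ) : ℝ) : ℂ) = (N : ℂ) := by
    have := hN
    rw [mul_comm (N : ℂ)] at this
    exact mul_left_cancel₀ h2 this
  have hkn : (k : ℝ) / n = N := by exact_mod_cast this
  rw [div_eq_iff (by exact_mod_cast hn)] at hkn
  apply hk
  -- k = N * n with N an integer, k, n naturals
  have hN0 : 0 ≤ N := by
    by_contra hneg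
    push Not at hneg
    have : (k : ℝ) < 0 := by
      rw [hkn]
      exact mul_neg_of_neg_of_pos (by exact_mod_cast hneg) (by exact_mod_cast Nat.pos_of_ne_zero hn)
    linarith [(Nat.cast_nonneg k : (0 : ℝ) ≤ k)]
  obtain ⟨M, rfl⟩ := Int.eq_ofNat_of_zero_le hN0
  refine ⟨M, ?_⟩
  have : (k : ℝ) = (n * M : ℕ) := by rw [hkn]; push_cast; ring
  exact_mod_cast this

/-! ## §1b Gon sums at lattice times -/

/-- conjugate of an atom as base point plus `-β i` times the coordinate sum. -/
theorem conj_atom (σ β γ : ℝ) {n : ℕ} (j : Fin n × Fin n × Fin n) :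
    conj (atom σ β γ j) = conj ((σ : ℂ) + (γ : ℂ) * I) + (-(β : ℂ) * I) * ((tsumIdx j : ℕ) : ℂ) := by
  simp only [atom, map_add, map_mul, Complex.conj_ofReal, Complex.conj_I, map_natCast]
  ring

/-- the lattice phase of an atom: at `t = k h` with `β = 2π/(nh)`, `e^{atom·t} = e^{(σ+iγ)t} ω^{j₁+j₂+j₃}`,
`ω = e^{2πik/n}`. -/
theorem exp_atom_mul (σ β γ h : ℝ) (hh : h ≠ 0) {n : ℕ} (hn : n ≠ 0) (hβ : β = 2 * Real.pi / (n * h))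
    (k : ℕ) (j : Fin n × Fin n × Fin n) :
    Complex.exp (atom σ β γ j * (((k : ℝ) * h : ℝ) : ℂ)) =
      Complex.exp (((σ : ℂ) + (γ : ℂ) * I) * (((k : ℝ) * h : ℝ) : ℂ)) *
        Complex.exp (2 * Real.pi * I * ((k : ℝ) / (n : ℝ) : ℝ)) ^ tsumIdx j := by
  rw [← Complex.exp_nat_mul, ← Complex.exp_add]
  congr 1
  have hh' : (h : ℂ) ≠ 0 := by exact_mod_cast hh
  have hn' : (n : ℂ) ≠ 0 := by exact_mod_cast hn
  simp only [atom, hβ]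
  push_cast
  field_simp
  ring

/-- **Invisibility**: a cubed gon of order `n` on the lattice `hℕ` has vanishing moment sums of orders `0,1,2` at
every `t = kh` with `n ∤ k`. -/
theorem gon_sum_eq_zero (σ β γ h : ℝ) (hh : h ≠ 0) {n : ℕ} (hn : n ≠ 0) (hβ : β = 2 * Real.pi / (n * h))
    {k : ℕ} (hk : ¬ n ∣ k) {r : ℕ} (hr : r ≤ 2) :
    (∑ j : Fin n × Fin n × Fin n, conj (atom σ β γ j) ^ r * Complex.exp (atom σ β γ j * (((k : ℝ) * h : ℝ) : ℂ)))
      = 0 := by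
  simp_rw [exp_atom_mul σ β γ h hh hn hβ k, conj_atom]
  set ω := Complex.exp (2 * Real.pi * I * ((k : ℝ) / (n : ℝ) : ℝ)) with hω
  have hZ : Zs n 0 ω = 0 := Zs_zero_eq_zero (omega_pow_eq_one n k hn) (omega_ne_one hn hk)
  have e : ∀ j : Fin n × Fin n × Fin n,
      (conj ((σ : ℂ) + (γ : ℂ) * I) + (-(β : ℂ) * I) * ((tsumIdx j : ℕ) : ℂ)) ^ r *
        (Complex.exp (((σ : ℂ) + (γ : ℂ) * I) * (((k : ℝ) * h : ℝ) : ℂ)) * ω ^ tsumIdx j) =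
      Complex.exp (((σ : ℂ) + (γ : ℂ) * I) * (((k : ℝ) * h : ℝ) : ℂ)) *
        ((conj ((σ : ℂ) + (γ : ℂ) * I) + (-(β : ℂ) * I) * ((tsumIdx j : ℕ) : ℂ)) ^ r * ω ^ tsumIdx j) :=
    fun j ↦ by ring
  simp_rw [e, ← Finset.mul_sum, cubed_sum_zero hZ _ _ hr, mul_zero]

/-- **At multiples of the order** the lattice phases are trivial: at `t = (j' n) h` the moment sum of a cubed gon is
`e^{(σ+iγ)t} · n³ W_r`. -/
theorem gon_sum_multiple (σ β γ h : ℝ) (hh : h ≠ 0) {n : ℕ} (hn : n ≠ 0) (hβ : β = 2 * Real.pi / (n * h))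
    (j' : ℕ) (r : ℕ) :
    (∑ j : Fin n × Fin n × Fin n, conj (atom σ β γ j) ^ r *
        Complex.exp (atom σ β γ j * ((((j' * n : ℕ) : ℝ) * h : ℝ) : ℂ))) =
      Complex.exp (((σ : ℂ) + (γ : ℂ) * I) * ((((j' * n : ℕ) : ℝ) * h : ℝ) : ℂ)) *
        ((n : ℂ) ^ 3 * Wm n σ β γ r) := by
  have hω : Complex.exp (2 * Real.pi * I * ((((j' * n : ℕ) : ℕ) : ℝ) / (n : ℝ) : ℝ)) = 1 := by
    have : (2 * Real.pi * I * (((((j' * n : ℕ) : ℕ) : ℝ) / (n : ℝ) : ℝ) : ℂ)) = (j' : ℕ) * (2 * Real.pi * I) := by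
      push_cast
      field_simp
    rw [this]
    exact Complex.exp_nat_mul_two_pi_mul_I j'
  simp_rw [exp_atom_mul σ β γ h hh hn hβ (j' * n), hω, one_pow, mul_one]
  rw [Wm, mul_div_cancel₀ _ (pow_ne_zero 3 (by exact_mod_cast hn)), Finset.mul_sum]
  exact Finset.sum_congr rfl fun _ _ ↦ by ring

/-! ## §1c The shift lemma for the normalised moments -/

/-- the zeroth normalised moment of a cubed gon is `1`. -/
theorem Wm_zero {n : ℕ} (hn : n ≠ 0) (σ β γ : ℝ) : Wm n σ β γ 0 = 1 := by
  simp only [Wm, pow_zero, Finset.sum_const, Finset.card_univ, nsmul_eq_mul, mul_one]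
  rw [Fintype.card_prod, Fintype.card_prod, Fintype.card_fin]
  push_cast
  rw [div_eq_one_iff_eq (pow_ne_zero 3 (by exact_mod_cast hn))]
  ring

/-- raising the base height by `δ` shifts every atom by `δ i`. -/
theorem atom_shift (σ β γ δ : ℝ) {n : ℕ} (j : Fin n × Fin n × Fin n) :
    conj (atom σ β (γ + δ) j) = conj (atom σ β γ j) - (δ : ℂ) * I := by
  simp only [atom, map_add, map_mul, Complex.conj_ofReal, Complex.conj_I, map_natCast, Complex.ofReal_add]
  ring

/-- first moment under a height shift: `W₁(γ+δ) = W₁(γ) - δ i`. -/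
theorem Wm_one_shift {n : ℕ} (hn : n ≠ 0) (σ β γ δ : ℝ) :
    Wm n σ β (γ + δ) 1 = Wm n σ β γ 1 - (δ : ℂ) * I := by
  have h3 : ((n : ℂ) ^ 3) ≠ 0 := pow_ne_zero 3 (by exact_mod_cast hn)
  simp only [Wm, pow_one, atom_shift, Finset.sum_sub_distrib, Finset.sum_const, Finset.card_univ,
    nsmul_eq_mul]
  rw [Fintype.card_prod, Fintype.card_prod, Fintype.card_fin]
  push_cast
  field_simp

/-- second moment under a height shift: `W₂(γ+δ) = W₂(γ) - 2 δ i W₁(γ) - δ²`. -/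
theorem Wm_two_shift {n : ℕ} (hn : n ≠ 0) (σ β γ δ : ℝ) :
    Wm n σ β (γ + δ) 2 = Wm n σ β γ 2 - 2 * ((δ : ℂ) * I) * Wm n σ β γ 1 - (δ : ℂ) ^ 2 := by
  have h3 : ((n : ℂ) ^ 3) ≠ 0 := pow_ne_zero 3 (by exact_mod_cast hn)
  have e : ∀ j : Fin n × Fin n × Fin n, conj (atom σ β (γ + δ) j) ^ 2 =
      conj (atom σ β γ j) ^ 2 - 2 * ((δ : ℂ) * I) * conj (atom σ β γ j) ^ 1 + ((δ : ℂ) * I) ^ 2 := by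
    intro j; rw [atom_shift]; ring
  simp only [Wm, e, Finset.sum_add_distrib, Finset.sum_sub_distrib, ← Finset.mul_sum, Finset.sum_const,
    Finset.card_univ, nsmul_eq_mul]
  rw [Fintype.card_prod, Fintype.card_prod, Fintype.card_fin]
  push_cast
  field_simp
  rw [I_sq]
  ring

/-- size of the normalised moments: `|W_r| ≤ M^r` when every atom has `|atom| ≤ M`. -/
theorem norm_Wm_le {n : ℕ} (hn : n ≠ 0) (σ β γ M : ℝ) (r : ℕ)
    (hM : ∀ j : Fin n × Fin n × Fin n, ‖atom σ β γ j‖ ≤ M) : ‖Wm n σ β γ r‖ ≤ M ^ r := by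
  have h3 : (0 : ℝ) < (n : ℝ) ^ 3 := by positivity
  rw [Wm, norm_div, norm_pow, Complex.norm_natCast, div_le_iff₀ h3]
  calc ‖∑ j : Fin n × Fin n × Fin n, conj (atom σ β γ j) ^ r‖
      ≤ ∑ j : Fin n × Fin n × Fin n, ‖conj (atom σ β γ j) ^ r‖ := norm_sum_le _ _
    _ ≤ ∑ _j : Fin n × Fin n × Fin n, M ^ r := Finset.sum_le_sum fun j _ ↦ by
        rw [norm_pow, Complex.norm_conj]; exact pow_le_pow_left₀ (norm_nonneg _) (hM j) r
    _ = M ^ r * (n : ℝ) ^ 3 := by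
        rw [Finset.sum_const, Finset.card_univ, Fintype.card_prod, Fintype.card_prod, Fintype.card_fin,
          nsmul_eq_mul]
        push_cast; ring

end Summit.RiemannHypothesis.RiemannHypothesis.Theorems.TwoPrimeFoldRigidity.Negative.MBT
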